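import Mathlib
import Summits.NavierStokesRegularity.NavierStokesRegularity.Theorems.EulerZoomLiouvillePowerGaugeEulerLiouvilleCondenserShellCondenser

/-!
# (B‴) THE SCALAR/PLANAR SHELL CONDENSER (nsreg-p2 g36 ROUND-46 v1.1 §7, plate t49-B‴, `r46/Sketch46b.lean` sha16 642a48bf5342366b,
Prop `NsregP2.R46b.ScalarPlanarShellCondenser`; seeds R47-1)

Width piece for crux `EulerZoomLiouville.PowerGaugeEulerLiouville` (stmt-NavierStokesRegularity-19832), by name under LEAD 19832
(ns-typeII-p2); seat ns-sfl-p1 g7, `--supports stmt-NavierStokesRegularity-19832 --as helper`.  Text binder-for-binder (`E3`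
spelled out).

The twin of R46 (B″) `Condenser.shellCondenser_of` (p678940) for a SCALAR `ψ ∈ C¹(ℝ³)` (in K‴: `ψ = −⟪V, e⟫`): amplitude
`γ s ≤ ψ(y₁)` at the crossings, budget = the PLANAR Dirichlet energy `‖∇ψ‖² − (∂_e ψ)²` of the shell, same conclusion as (B″).
Same proof with the circular-mean core (C) `Condenser.circleMeanCondenserCore_of` applied to the slice function `ψ ∘ Φ_{y₁'}` DIRECTLY
(no unit-vector selection); the one new line is the planar chain rule
`‖D(φ ∘ Φ_y)(z)‖² ≤ ‖Dφ(Φ_y z)‖² − (Dφ(Φ_y z) e₂)²` (`norm_fderiv_comp_cchart_sq_le_planar`: the derivative through the chart only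
sees the `e₀, e₁` partials; Parseval `OrthonormalBasis.sum_sq_inner_left` for the Riesz vector of `Dφ`), after rotating `e ↦ e₂`
(`fderiv (ψ ∘ Rot⁻¹) x e₂ = fderiv ψ (Rot⁻¹x) e`).

* `sum_sq_apply_basisFun_eq_norm_sq`, `norm_fderiv_comp_cchart_sq_le_planar`, `setIntegral_cdisc_sq_norm_fderiv_planar_le`,
  `setIntegral_cdisc_sq_scalar_le` — tools;
* `scalarPlanarShellCondenser_of` / `scalarPlanarShellCondenser` — the plate (the latter = the Sketch46b text VERBATIM).

HONEST FRAMING: real analysis in `ℝ³`; nothing here proves the crux E (19832 OPEN), any door Target, or any Navier–Stokes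
statement; no summit statement is touched. [folklore (length–area method); cite: ConstantinIgnatovaVicol2026Putative, §3.4.1
for the setting]
-/

noncomputable section

open Set Filter Topology Metric Function MeasureTheory Real
open scoped RealInnerProductSpace

set_option linter.dupNamespace false

namespace Summit.NavierStokesRegularity.NavierStokesRegularity.Theorems.PowerGaugeEulerLiouville.Condenser

open Literature.Analysis Literature.Analysis.FluidPDE

/-! ## The planar chain rule through the `ℂ`-chart -/

/-- Parseval for a functional on `ℝ³`: `Σᵢ (L eᵢ)² = ‖L‖²` in the standard basis. [folklore] -/
theorem sum_sq_apply_basisFun_eq_norm_sq (L : EuclideanSpace ℝ (Fin 3) →L[ℝ] ℝ) :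
    ∑ i : Fin 3, (L (EuclideanSpace.basisFun (Fin 3) ℝ i)) ^ 2 = ‖L‖ ^ 2 := by
  set v : EuclideanSpace ℝ (Fin 3) := (InnerProductSpace.toDual ℝ (EuclideanSpace ℝ (Fin 3))).symm L with hv
  have hLv : ∀ x, L x = ⟪v, x⟫ := fun x => by rw [hv, InnerProductSpace.toDual_symm_apply]
  have hnorm : ‖v‖ = ‖L‖ := by rw [hv]; exact LinearIsometryEquiv.norm_map _ _
  simp_rw [hLv]
  rw [(EuclideanSpace.basisFun (Fin 3) ℝ).sum_sq_inner_left v, hnorm]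

/-- The linear part of the chart followed by a functional: `(L ∘ ι) w = re w · L e₀ + im w · L e₁`, hence
`‖L ∘ ι‖² ≤ (L e₀)² + (L e₁)²`. [folklore] -/
theorem opNorm_comp_cchartLin_sq_le (L : EuclideanSpace ℝ (Fin 3) →L[ℝ] ℝ) :
    ‖L.comp (Complex.reCLM.smulRight (EuclideanSpace.basisFun (Fin 3) ℝ 0) +
        Complex.imCLM.smulRight (EuclideanSpace.basisFun (Fin 3) ℝ 1))‖ ^ 2 ≤
      (L (EuclideanSpace.basisFun (Fin 3) ℝ 0)) ^ 2 + (L (EuclideanSpace.basisFun (Fin 3) ℝ 1)) ^ 2 := by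
  set a : ℝ := L (EuclideanSpace.basisFun (Fin 3) ℝ 0) with ha
  set b : ℝ := L (EuclideanSpace.basisFun (Fin 3) ℝ 1) with hb
  have hM : 0 ≤ Real.sqrt (a ^ 2 + b ^ 2) := Real.sqrt_nonneg _
  have hop : ‖L.comp (Complex.reCLM.smulRight (EuclideanSpace.basisFun (Fin 3) ℝ 0) +
      Complex.imCLM.smulRight (EuclideanSpace.basisFun (Fin 3) ℝ 1))‖ ≤ Real.sqrt (a ^ 2 + b ^ 2) := by
    refine ContinuousLinearMap.opNorm_le_bound _ hM fun w => ?_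
    rw [ContinuousLinearMap.comp_apply, cchartLin_apply, map_add, map_smul, map_smul, smul_eq_mul, smul_eq_mul,
      Real.norm_eq_abs]
    have hw : ‖w‖ = Real.sqrt (w.re ^ 2 + w.im ^ 2) := by
      rw [← Real.sqrt_sq (norm_nonneg w), Complex.sq_norm, Complex.normSq_apply]; ring_nf
    rw [hw, ← Real.sqrt_mul (by positivity)]
    refine Real.abs_le_sqrt ?_
    nlinarith [sq_nonneg (a * w.im - b * w.re)]
  have h0 : 0 ≤ ‖L.comp (Complex.reCLM.smulRight (EuclideanSpace.basisFun (Fin 3) ℝ 0) +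
      Complex.imCLM.smulRight (EuclideanSpace.basisFun (Fin 3) ℝ 1))‖ := norm_nonneg _
  calc ‖L.comp (Complex.reCLM.smulRight (EuclideanSpace.basisFun (Fin 3) ℝ 0) +
        Complex.imCLM.smulRight (EuclideanSpace.basisFun (Fin 3) ℝ 1))‖ ^ 2 ≤ (Real.sqrt (a ^ 2 + b ^ 2)) ^ 2 :=
        pow_le_pow_left₀ h0 hop 2
    _ = a ^ 2 + b ^ 2 := Real.sq_sqrt (by positivity)

/-- **The planar chain rule**: for a differentiable scalar `φ : ℝ³ → ℝ`,
`‖D(φ ∘ Φ_y)(z)‖² ≤ ‖Dφ(Φ_y z)‖² − (Dφ(Φ_y z) e₂)²` — the derivative through the chart drops the `e₂`-partial. [folklore] -/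
theorem norm_fderiv_comp_cchart_sq_le_planar {φ : EuclideanSpace ℝ (Fin 3) → ℝ} (hφ : Differentiable ℝ φ)
    (y : EuclideanSpace ℝ (Fin 3)) (z : ℂ) :
    ‖fderiv ℝ (fun z : ℂ =>
        φ (y + z.re • EuclideanSpace.basisFun (Fin 3) ℝ 0 + z.im • EuclideanSpace.basisFun (Fin 3) ℝ 1)) z‖ ^ 2 ≤
      ‖fderiv ℝ φ (y + z.re • EuclideanSpace.basisFun (Fin 3) ℝ 0 + z.im • EuclideanSpace.basisFun (Fin 3) ℝ 1)‖ ^ 2 -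
        (fderiv ℝ φ (y + z.re • EuclideanSpace.basisFun (Fin 3) ℝ 0 + z.im • EuclideanSpace.basisFun (Fin 3) ℝ 1)
          (EuclideanSpace.basisFun (Fin 3) ℝ 2)) ^ 2 := by
  set L := fderiv ℝ φ (y + z.re • EuclideanSpace.basisFun (Fin 3) ℝ 0 + z.im • EuclideanSpace.basisFun (Fin 3) ℝ 1)
    with hL
  have h : HasFDerivAt (fun z : ℂ =>
      φ (y + z.re • EuclideanSpace.basisFun (Fin 3) ℝ 0 + z.im • EuclideanSpace.basisFun (Fin 3) ℝ 1))
      (L.comp (Complex.reCLM.smulRight (EuclideanSpace.basisFun (Fin 3) ℝ 0) +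
          Complex.imCLM.smulRight (EuclideanSpace.basisFun (Fin 3) ℝ 1))) z :=
    (hφ _).hasFDerivAt.comp z (hasFDerivAt_cchart y z)
  rw [h.fderiv]
  have hsum := sum_sq_apply_basisFun_eq_norm_sq L
  rw [Fin.sum_univ_three] at hsum
  have h2 := opNorm_comp_cchartLin_sq_le L
  linarith

/-- **Planar energy budget on the disc.**  For `φ ∈ C¹(ℝ³)`, `‖y‖ + r < R'`:
`∫_{closedBall (0:ℂ) r} ‖D(φ ∘ Φ_y)‖² dz ≤ ∫ a, 𝟙_{B(0,R')} (‖Dφ‖² − (Dφ e₂)²) (plane (y 2) a)`. [folklore] -/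
theorem setIntegral_cdisc_sq_norm_fderiv_planar_le {φ : EuclideanSpace ℝ (Fin 3) → ℝ} (hφ : ContDiff ℝ 1 φ)
    {y : EuclideanSpace ℝ (Fin 3)} {R' r : ℝ} (hfit : ‖y‖ + r < R') :
    ∫ z in closedBall (0 : ℂ) r, ‖fderiv ℝ (fun z : ℂ =>
        φ (y + z.re • EuclideanSpace.basisFun (Fin 3) ℝ 0 + z.im • EuclideanSpace.basisFun (Fin 3) ℝ 1)) z‖ ^ 2 ≤
      ∫ a, (ball (0 : EuclideanSpace ℝ (Fin 3)) R').indicator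
        (fun x => ‖fderiv ℝ φ x‖ ^ 2 - (fderiv ℝ φ x (EuclideanSpace.basisFun (Fin 3) ℝ 2)) ^ 2) (plane (y 2) a) := by
  have hφd : Differentiable ℝ φ := hφ.differentiable one_ne_zero
  have hDφc : Continuous (fderiv ℝ φ) := hφ.continuous_fderiv one_ne_zero
  have hGc : Continuous fun x => ‖fderiv ℝ φ x‖ ^ 2 - (fderiv ℝ φ x (EuclideanSpace.basisFun (Fin 3) ℝ 2)) ^ 2 :=
    (hDφc.norm.pow 2).sub ((hDφc.clm_apply continuous_const).pow 2)
  have hG0 : ∀ x, 0 ≤ ‖fderiv ℝ φ x‖ ^ 2 - (fderiv ℝ φ x (EuclideanSpace.basisFun (Fin 3) ℝ 2)) ^ 2 := by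
    intro x
    have hsum := sum_sq_apply_basisFun_eq_norm_sq (fderiv ℝ φ x)
    rw [Fin.sum_univ_three] at hsum
    nlinarith [sq_nonneg (fderiv ℝ φ x (EuclideanSpace.basisFun (Fin 3) ℝ 0)),
      sq_nonneg (fderiv ℝ φ x (EuclideanSpace.basisFun (Fin 3) ℝ 1))]
  have hΦc := (contDiff_cchart y (n := 1)).continuous
  have hψ : ContDiff ℝ 1 (fun z : ℂ =>
      φ (y + z.re • EuclideanSpace.basisFun (Fin 3) ℝ 0 + z.im • EuclideanSpace.basisFun (Fin 3) ℝ 1)) :=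
    contDiff_comp_cchart hφ y
  refine le_trans ?_ (setIntegral_cdisc_le_integral_plane hGc hG0 hfit)
  refine setIntegral_mono_on ?_ ?_ measurableSet_closedBall fun z _ => norm_fderiv_comp_cchart_sq_le_planar hφd y z
  · exact ((hψ.continuous_fderiv one_ne_zero).norm.pow 2).continuousOn.integrableOn_compact (isCompact_closedBall _ _)
  · exact (hGc.comp hΦc).continuousOn.integrableOn_compact (isCompact_closedBall _ _)

/-- **Amplitude budget on the disc, scalar form.**  For continuous `φ`, `‖y‖ + r < R'`:
`∫_{closedBall (0:ℂ) r} φ(Φ_y z)² dz ≤ ∫ a, 𝟙_{B(0,R')} φ² (plane (y 2) a)`. [folklore] -/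
theorem setIntegral_cdisc_sq_scalar_le {φ : EuclideanSpace ℝ (Fin 3) → ℝ} (hφ : Continuous φ)
    {y : EuclideanSpace ℝ (Fin 3)} {R' r : ℝ} (hfit : ‖y‖ + r < R') :
    ∫ z in closedBall (0 : ℂ) r,
        φ (y + z.re • EuclideanSpace.basisFun (Fin 3) ℝ 0 + z.im • EuclideanSpace.basisFun (Fin 3) ℝ 1) ^ 2 ≤
      ∫ a, (ball (0 : EuclideanSpace ℝ (Fin 3)) R').indicator (fun x => φ x ^ 2) (plane (y 2) a) :=
  setIntegral_cdisc_le_integral_plane (G := fun x => φ x ^ 2) (hφ.pow 2) (fun _ => sq_nonneg _) hfit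

/-! ## The scalar/planar shell condenser -/

set_option maxHeartbeats 400000 in
/-- **(B‴) THE SCALAR/PLANAR SHELL CONDENSER.**  See the module docstring. [folklore (length–area method);
cite: ConstantinIgnatovaVicol2026Putative, §3.4.1 for the setting] -/
theorem scalarPlanarShellCondenser_of {ψ : EuclideanSpace ℝ (Fin 3) → ℝ} (hψ : ContDiff ℝ 1 ψ)
    {e : EuclideanSpace ℝ (Fin 3)} (he : ‖e‖ = 1)
    {γ ℓ₁ ℓ₂ r R' η δ X S G : ℝ} (hγ : 0 < γ) (hℓ₁ : 0 < ℓ₁) (hℓ : ℓ₁ < ℓ₂) (hr : 0 < r) (hR' : ℓ₂ + r < R')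
    (hη : 0 < η) (hη1 : η < 1) (hδ : 0 < δ) (hδ2 : δ < 1 / 2) (hX : 0 < X) (hS : 0 < S)
    (hA : ∫ x in ball (0 : EuclideanSpace ℝ (Fin 3)) R', ψ x ^ 2 ≤ X)
    (hE : ∫ x in ball (0 : EuclideanSpace ℝ (Fin 3)) R' ∩ {x | ℓ₁ ≤ ‖x‖},
      (‖fderiv ℝ ψ x‖ ^ 2 - (fderiv ℝ ψ x e) ^ 2) ≤ S)
    (hG : ∀ z ∈ ball (0 : EuclideanSpace ℝ (Fin 3)) R', ‖fderiv ℝ ψ z‖ ≤ G)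
    (hsmall : Real.sqrt (2 * (X / (η * (ℓ₂ - ℓ₁))) / Real.pi) / r ≤ δ * (γ * ℓ₁))
    (hcross : ∀ s ∈ Icc ℓ₁ ℓ₂, ∃ y₁ : EuclideanSpace ℝ (Fin 3), ⟪y₁, e⟫ = s ∧ ‖y₁‖ ≤ ℓ₂ ∧ γ * s ≤ ψ y₁) :
    δ * (γ * ℓ₁) / r *
        Real.exp (2 * Real.pi * ((1 - 2 * δ) * γ) ^ 2 *
          (((ℓ₁ + (1 - η) * (ℓ₂ - ℓ₁)) ^ 3 - ℓ₁ ^ 3) / (3 * S))) ≤ G := by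
  -- rotate `e` to `e₂`
  set e₂ : EuclideanSpace ℝ (Fin 3) := EuclideanSpace.basisFun (Fin 3) ℝ 2 with he₂
  have he₂1 : ‖e₂‖ = 1 := (EuclideanSpace.basisFun (Fin 3) ℝ).orthonormal.1 2
  obtain ⟨Rot, hRot⟩ := exists_linearIsometryEquiv_apply_eq he he₂1
  have hRot' : Rot.symm e₂ = e := by rw [← hRot, Rot.symm_apply_apply]
  -- the rotated scalar
  set φ : EuclideanSpace ℝ (Fin 3) → ℝ := fun z => ψ (Rot.symm z) with hφ
  have hφc : ContDiff ℝ 1 φ := hψ.comp Rot.symm.toContinuousLinearEquiv.contDiff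
  have hφd : Differentiable ℝ φ := hφc.differentiable one_ne_zero
  have hψd : Differentiable ℝ ψ := hψ.differentiable one_ne_zero
  have hDφ : ∀ x, ‖fderiv ℝ φ x‖ = ‖fderiv ℝ ψ (Rot.symm x)‖ := norm_fderiv_comp_linearIsometryEquiv ψ Rot
  have hfdφ : ∀ x, fderiv ℝ φ x = (fderiv ℝ ψ (Rot.symm x)).comp (Rot.symm.toContinuousLinearEquiv : _ →L[ℝ] _) := by
    intro x
    rw [show φ = ψ ∘ (Rot.symm.toContinuousLinearEquiv : EuclideanSpace ℝ (Fin 3) → EuclideanSpace ℝ (Fin 3)) from rfl,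
      ContinuousLinearEquiv.comp_right_fderiv]
    rfl
  have hDφe : ∀ x, fderiv ℝ φ x e₂ = fderiv ℝ ψ (Rot.symm x) e := by
    intro x
    rw [hfdφ x, ContinuousLinearMap.comp_apply]
    simp [hRot']
  have hplanar : ∀ x, ‖fderiv ℝ φ x‖ ^ 2 - (fderiv ℝ φ x e₂) ^ 2 =
      ‖fderiv ℝ ψ (Rot.symm x)‖ ^ 2 - (fderiv ℝ ψ (Rot.symm x) e) ^ 2 := fun x => by rw [hDφ, hDφe]
  have hDφc : Continuous (fderiv ℝ φ) := hφc.continuous_fderiv one_ne_zero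
  have hPc : Continuous fun x => ‖fderiv ℝ φ x‖ ^ 2 - (fderiv ℝ φ x e₂) ^ 2 :=
    (hDφc.norm.pow 2).sub ((hDφc.clm_apply continuous_const).pow 2)
  have hP0 : ∀ x, 0 ≤ ‖fderiv ℝ φ x‖ ^ 2 - (fderiv ℝ φ x e₂) ^ 2 := by
    intro x
    have hsum := sum_sq_apply_basisFun_eq_norm_sq (fderiv ℝ φ x)
    rw [Fin.sum_univ_three] at hsum
    rw [he₂]
    nlinarith [sq_nonneg (fderiv ℝ φ x (EuclideanSpace.basisFun (Fin 3) ℝ 0)),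
      sq_nonneg (fderiv ℝ φ x (EuclideanSpace.basisFun (Fin 3) ℝ 1))]
  -- budgets for `φ`: ball (amplitude), shell ⊇ slab (planar energy)
  have hA' : ∫ x in ball (0 : EuclideanSpace ℝ (Fin 3)) R', φ x ^ 2 ≤ X := by
    have h := setIntegral_ball_comp_linearIsometryEquiv (fun x => ψ x ^ 2) Rot R'
    simp only [hφ]
    rw [h]; exact hA
  have hE' : ∫ x in ball (0 : EuclideanSpace ℝ (Fin 3)) R' ∩ {x | ℓ₁ ≤ ‖x‖},
      (‖fderiv ℝ φ x‖ ^ 2 - (fderiv ℝ φ x e₂) ^ 2) ≤ S := by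
    have h := setIntegral_ballShell_comp_linearIsometryEquiv (fun x => ‖fderiv ℝ ψ x‖ ^ 2 - (fderiv ℝ ψ x e) ^ 2)
      Rot R' ℓ₁
    simp_rw [hplanar]
    rw [h]; exact hE
  have hEslab : ∫ x in ball (0 : EuclideanSpace ℝ (Fin 3)) R' ∩ {x | ℓ₁ ≤ x 2},
      (‖fderiv ℝ φ x‖ ^ 2 - (fderiv ℝ φ x e₂) ^ 2) ≤ S :=
    (setIntegral_ballSlab_le_ballShell hPc hP0 R' ℓ₁).trans hE'
  -- the weighted quiet slice on the window, slab budget (t48-Q″)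
  obtain ⟨s, hs, hFs, hGs⟩ := weightedQuietSliceShell_of (F := fun x => φ x ^ 2)
    (G := fun x => ‖fderiv ℝ φ x‖ ^ 2 - (fderiv ℝ φ x e₂) ^ 2) (hφc.continuous.pow 2) hPc (fun _ => sq_nonneg _)
    hP0 hℓ₁ hℓ hη hη1 hX hS hA' hEslab
  have hsℓ : ℓ₁ ≤ s := hs.1
  have hspos : 0 < s := hℓ₁.trans_le hsℓ
  -- the anomalous point on it, rotated
  obtain ⟨y₁, hy₁e, hy₁n, hy₁V⟩ := hcross s hs
  set y₁' : EuclideanSpace ℝ (Fin 3) := Rot y₁ with hy₁'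
  have hy₁'2 : y₁' 2 = s := by
    rw [← EuclideanSpace.inner_basisFun_real (x := y₁') (i := 2), ← he₂, hy₁', ← hRot, Rot.inner_map_map, hy₁e]
  have hy₁'n : ‖y₁'‖ ≤ ℓ₂ := by rw [hy₁', Rot.norm_map]; exact hy₁n
  have hm : 0 < γ * s := mul_pos hγ hspos
  -- the slice function through the `ℂ`-chart at `y₁'`
  set χ : ℂ → ℝ := fun z =>
    φ (y₁' + z.re • EuclideanSpace.basisFun (Fin 3) ℝ 0 + z.im • EuclideanSpace.basisFun (Fin 3) ℝ 1) with hχ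
  have hχc : ContDiff ℝ 1 χ := contDiff_comp_cchart hφc y₁'
  have hχ0 : γ * s ≤ χ 0 := by
    have h0 : χ 0 = ψ y₁ := by
      simp only [hχ, Complex.zero_re, Complex.zero_im, zero_smul, add_zero, hφ, hy₁', Rot.symm_apply_apply]
    rw [h0]; exact hy₁V
  have hfit : ‖y₁'‖ + r < R' := by linarith
  have hGχ : ∀ z ∈ closedBall (0 : ℂ) r, ‖fderiv ℝ χ z‖ ≤ G := by
    intro z hz
    refine (norm_fderiv_comp_cchart_le hφd y₁' z).trans ?_
    rw [hDφ]
    apply hG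
    rw [mem_ball, dist_zero_right, Rot.symm.norm_map]
    rw [mem_closedBall, dist_zero_right] at hz
    exact (norm_cchart_le y₁' z).trans_lt (by linarith)
  -- disc budgets from the slice budgets
  set A : ℝ := X / (η * (ℓ₂ - ℓ₁)) with hAdef
  set D : ℝ := (ℓ₁ + (1 - η) * (ℓ₂ - ℓ₁)) ^ 3 - ℓ₁ ^ 3 with hDdef
  have hAχ : ∫ z in closedBall (0 : ℂ) r, χ z ^ 2 ≤ A := by
    have h := setIntegral_cdisc_sq_scalar_le hφc.continuous hfit (φ := φ)
    rw [hy₁'2] at h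
    exact h.trans hFs
  have hEχ : ∫ z in closedBall (0 : ℂ) r, ‖fderiv ℝ χ z‖ ^ 2 ≤ 3 * S / D * s ^ 2 := by
    have h := setIntegral_cdisc_sq_norm_fderiv_planar_le hφc hfit (y := y₁')
    rw [hy₁'2] at h
    exact h.trans hGs
  have hbase : ℓ₁ < ℓ₁ + (1 - η) * (ℓ₂ - ℓ₁) := by nlinarith
  have hD : 0 < D := by
    have h2 := pow_lt_pow_left₀ hbase hℓ₁.le (n := 3) (by norm_num)
    rw [hDdef]; linarith
  have hEs : 0 < 3 * S / D * s ^ 2 := by positivity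
  -- the circular-mean core (t47-C)
  have hcore := circleMeanCondenserCore_of hχc hm hχ0 hr hδ hEs hGχ hAχ hEχ
  set B : ℝ := Real.sqrt (2 * A / Real.pi) / r with hBdef
  have hBs : B ≤ δ * (γ * s) := by
    have h1 : δ * (γ * ℓ₁) ≤ δ * (γ * s) :=
      mul_le_mul_of_nonneg_left (mul_le_mul_of_nonneg_left hsℓ hγ.le) hδ.le
    exact hsmall.trans h1
  rcases hcore with h | h
  · exfalso
    nlinarith
  · have hpre : δ * (γ * ℓ₁) / r ≤ δ * (γ * s) / r :=
      div_le_div_of_nonneg_right (mul_le_mul_of_nonneg_left (mul_le_mul_of_nonneg_left hsℓ hγ.le) hδ.le) hr.le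
    have hlow0 : 0 ≤ (1 - 2 * δ) * γ * s := by
      have : 0 ≤ 1 - 2 * δ := by linarith
      positivity
    have hlow : (1 - 2 * δ) * γ * s ≤ (1 - δ) * (γ * s) - B := by linarith
    have hsq : ((1 - 2 * δ) * γ * s) ^ 2 ≤ ((1 - δ) * (γ * s) - B) ^ 2 := pow_le_pow_left₀ hlow0 hlow 2
    have hDS : D / (3 * S) * (3 * S / D) = 1 := by
      rw [div_mul_div_comm, mul_comm D (3 * S), div_self (ne_of_gt (by positivity))]
    have hexpo : 2 * Real.pi * ((1 - 2 * δ) * γ) ^ 2 * (D / (3 * S)) ≤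
        2 * Real.pi * ((1 - δ) * (γ * s) - B) ^ 2 / (3 * S / D * s ^ 2) := by
      rw [le_div_iff₀ hEs]
      calc 2 * Real.pi * ((1 - 2 * δ) * γ) ^ 2 * (D / (3 * S)) * (3 * S / D * s ^ 2)
          = 2 * Real.pi * ((1 - 2 * δ) * γ * s) ^ 2 * (D / (3 * S) * (3 * S / D)) := by ring
        _ = 2 * Real.pi * ((1 - 2 * δ) * γ * s) ^ 2 := by rw [hDS, mul_one]
        _ ≤ 2 * Real.pi * ((1 - δ) * (γ * s) - B) ^ 2 := mul_le_mul_of_nonneg_left hsq (by positivity)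
    have hexp := Real.exp_le_exp.2 hexpo
    have hb0 : 0 ≤ δ * (γ * s) / r := div_nonneg (mul_nonneg hδ.le (mul_nonneg hγ.le hspos.le)) hr.le
    have hstep := mul_le_mul hpre hexp (Real.exp_pos _).le hb0
    exact hstep.trans h

/-- **`NsregP2.R46b.ScalarPlanarShellCondenser`, binder-for-binder** (Sketch46b of nsreg-p2 g36, sha16 642a48bf5342366b, plate
t49-B‴; `E3` spelled out). [folklore (length–area method); cite: ConstantinIgnatovaVicol2026Putative, §3.4.1 for the setting] -/
theorem scalarPlanarShellCondenser :
    ∀ (ψ : EuclideanSpace ℝ (Fin 3) → ℝ), ContDiff ℝ 1 ψ → ∀ (e : EuclideanSpace ℝ (Fin 3)), ‖e‖ = 1 →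
      ∀ (γ ℓ₁ ℓ₂ r R' η δ X S G : ℝ), 0 < γ → 0 < ℓ₁ → ℓ₁ < ℓ₂ → 0 < r → ℓ₂ + r < R' → 0 < η → η < 1 →
        0 < δ → δ < 1 / 2 → 0 < X → 0 < S →
        (∫ x in ball (0 : EuclideanSpace ℝ (Fin 3)) R', ψ x ^ 2 ≤ X) →
        (∫ x in ball (0 : EuclideanSpace ℝ (Fin 3)) R' ∩ {x : EuclideanSpace ℝ (Fin 3) | ℓ₁ ≤ ‖x‖},
            (‖fderiv ℝ ψ x‖ ^ 2 - (fderiv ℝ ψ x e) ^ 2) ≤ S) →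
        (∀ z ∈ ball (0 : EuclideanSpace ℝ (Fin 3)) R', ‖fderiv ℝ ψ z‖ ≤ G) →
        Real.sqrt (2 * (X / (η * (ℓ₂ - ℓ₁))) / Real.pi) / r ≤ δ * (γ * ℓ₁) →
        (∀ s ∈ Icc ℓ₁ ℓ₂, ∃ y₁ : EuclideanSpace ℝ (Fin 3), ⟪y₁, e⟫ = s ∧ ‖y₁‖ ≤ ℓ₂ ∧ γ * s ≤ ψ y₁) →
        δ * (γ * ℓ₁) / r *
            Real.exp (2 * Real.pi * ((1 - 2 * δ) * γ) ^ 2 *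
              (((ℓ₁ + (1 - η) * (ℓ₂ - ℓ₁)) ^ 3 - ℓ₁ ^ 3) / (3 * S))) ≤ G :=
  fun _ hψ _ he _ _ _ _ _ _ _ _ _ _ hγ hℓ₁ hℓ hr hR' hη hη1 hδ hδ2 hX hS hA hE hG hsmall hcross =>
    scalarPlanarShellCondenser_of hψ he hγ hℓ₁ hℓ hr hR' hη hη1 hδ hδ2 hX hS hA hE hG hsmall hcross

end Summit.NavierStokesRegularity.NavierStokesRegularity.Theorems.PowerGaugeEulerLiouville.Condenser

end
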